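import Summits.RiemannHypothesis.RiemannHypothesis.Theorems.PfPersistenceMarkovCorePerronFrobenius
import Summits.RiemannHypothesis.RiemannHypothesis.Theorems.PfPersistenceMarkovCoreExistence
import HarnessLib

/-!
# PF persistence (theory 1, edge law): THE MARKOV CORE OF A NON-NEGATIVE WEIGHT TABLE, VII —
# the class statement `CorePerronFrobenius w a` and its named members

Helper file (`--supports stmt-RiemannHypothesis-19953`); mechanism/rigidity campaign; no RH claims.
This file only PACKAGES the theorems of `PfPersistenceMarkovCorePerronFrobenius` (uniqueness up to a
phase, strictly positive even representative, one-signedness of real ground states) and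
`PfPersistenceMarkovCoreExistence` (existence) into one proposition
`CorePerronFrobenius w a` — kernel Perron–Frobenius for the Markov core `𝓔^w_a` of the table `w` at
the window `[-a, a]` — proves it for EVERY table with `w n ≥ 0` on the prime index of the window and
every `a > 0` (`corePerronFrobenius`), records that it depends on the table only through its values
on the window's prime index (`corePerronFrobenius_congr`: tables agreeing below `2a` have the same
core data), and names the members of the class the campaign serves: ζ (`zetaTable`), the
archimedean-only form (`w ≡ 0`), deletions (`Set.indicator S w`), and non-negative reweightings /
dials (`K n * w n`, `K ≥ 0`).  Tables with a negative weight below `2a` (sign twists) are outside the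
class and nothing is claimed for them.

## References

* M. Reed, B. Simon, *Methods of Modern Mathematical Physics IV* (1978), §XIII.12 (Perron–Frobenius
  for positivity improving semigroups — the operator-theoretic statement this variational package
  replaces).
* E. Bombieri, Rend. Mat. Acc. Lincei (9) 11 (2000) 183–233, Thm 2 p. 193 (the energy form).
-/

set_option linter.dupNamespace false

noncomputable section

open MeasureTheory Set Filter
open scoped Topology ENNReal NNReal ComplexConjugate

namespace Summit.RiemannHypothesis.RiemannHypothesis.Theorems.PfPersistence

open Literature.NumberTheory.LFunctions
open Summit.RiemannHypothesis.RiemannHypothesis.Theorems.PfPersistenceDownCone (zetaTable)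

/-- **Kernel Perron–Frobenius for the Markov core of the table `w` at the window `[-a, a]`**:
(0) a core ground state exists; (1) core ground states are unique up to a unimodular constant;
(2) every core ground state is a.e. `γ·Φ` with `|γ| = 1`, `Φ` even, `Φ > 0` on `(-a, a)`, `Φ = 0` off
`[-a, a]`, `Φ` itself a core ground state; (3) every real-valued core ground state is one-signed a.e.
[cite: ReedSimonIV1978, §XIII.12 Thm XIII.44] -/
def CorePerronFrobenius (w : ℕ → ℝ) (a : ℝ) : Prop :=
  (∃ u : ℝ → ℂ, IsCoreGround w a u) ∧
    (∀ u₁ u₂ : ℝ → ℂ, IsCoreGround w a u₁ → IsCoreGround w a u₂ →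
      ∃ γ : ℂ, ‖γ‖ = 1 ∧ u₁ =ᵐ[volume] fun x ↦ γ * u₂ x) ∧
    (∀ u : ℝ → ℂ, IsCoreGround w a u →
      ∃ Φ : ℝ → ℝ, ∃ γ : ℂ, ‖γ‖ = 1 ∧ (∀ x, Φ (-x) = Φ x) ∧ (∀ x ∈ Ioo (-a) a, 0 < Φ x) ∧
        (∀ x, x ∉ Icc (-a) a → Φ x = 0) ∧ IsCoreGround w a (fun x ↦ (Φ x : ℂ)) ∧
        u =ᵐ[volume] fun x ↦ γ * (Φ x : ℂ)) ∧
    (∀ f : ℝ → ℝ, IsCoreGround w a (fun x ↦ (f x : ℂ)) →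
      (∀ᵐ x : ℝ, 0 ≤ f x) ∨ (∀ᵐ x : ℝ, f x ≤ 0))

/-- **Kernel Perron–Frobenius holds for the Markov core of EVERY non-negative table at EVERY window.**
[cite: ReedSimonIV1978, §XIII.12 Thm XIII.44] -/
theorem corePerronFrobenius {a : ℝ} {w : ℕ → ℝ} (hw : ∀ n ∈ weilPrimeIndex a, 0 ≤ w n)
    (ha : 0 < a) : CorePerronFrobenius w a :=
  ⟨exists_isCoreGround hw ha, fun _ _ h₁ h₂ ↦ h₁.unique hw ha h₂,
    fun _ hu ↦ hu.exists_pos_even_rep hw ha, fun _ hu ↦ hu.oneSigned_of_real hw ha⟩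

/-! ## The core sees the table only through the window's prime index -/

/-- Tables agreeing on the prime index of the window have the same energy form. [folklore] -/
theorem tableDirichletEnergy_congr_table {a : ℝ} {w w' : ℕ → ℝ}
    (h : ∀ n ∈ weilPrimeIndex a, w n = w' n) (f : ℝ → ℂ) :
    tableDirichletEnergy a w f = tableDirichletEnergy a w' f := by
  unfold tableDirichletEnergy
  rw [Finset.sum_congr rfl fun n hn ↦ by rw [h n hn]]

/-- Tables agreeing on the prime index of the window have the same core ground states. [folklore] -/
theorem isCoreGround_congr_table {a : ℝ} {w w' : ℕ → ℝ}
    (h : ∀ n ∈ weilPrimeIndex a, w n = w' n) (u : ℝ → ℂ) :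
    IsCoreGround w a u ↔ IsCoreGround w' a u := by
  have hset : coreSet w a = coreSet w' a := by
    ext x
    simp only [coreSet, Set.mem_setOf_eq, tableDirichletEnergy_congr_table h]
  have hbot : coreBottom w a = coreBottom w' a := by rw [coreBottom, coreBottom, hset]
  simp only [IsCoreGround, tableDirichletEnergy_congr_table h, hbot]

/-- **Twin wall for the core**: tables agreeing on the prime index of the window (i.e. below `2a`)
have the same kernel Perron–Frobenius data. [folklore] -/
theorem corePerronFrobenius_congr {a : ℝ} {w w' : ℕ → ℝ}
    (h : ∀ n ∈ weilPrimeIndex a, w n = w' n) :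
    CorePerronFrobenius w a ↔ CorePerronFrobenius w' a := by
  simp only [CorePerronFrobenius, isCoreGround_congr_table h]

/-! ## Named members of the class -/

/-- ζ (`w = Λ(n)/√n`). [cite: ReedSimonIV1978, §XIII.12 Thm XIII.44] -/
theorem corePerronFrobenius_zetaTable {a : ℝ} (ha : 0 < a) : CorePerronFrobenius zetaTable a :=
  corePerronFrobenius (fun n _ ↦ PfPersistenceDownCone.zetaTable_nonneg n) ha

/-- The archimedean-only form (`w ≡ 0`: all primes switched off, polar term absent by construction
of the core). [cite: ReedSimonIV1978, §XIII.12 Thm XIII.44] -/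
theorem corePerronFrobenius_archOnly {a : ℝ} (ha : 0 < a) : CorePerronFrobenius (fun _ ↦ 0) a :=
  corePerronFrobenius (fun _ _ ↦ le_rfl) ha

/-- Deletions: switching off any set of positions of a non-negative table (`Set.indicator S w`).
[cite: ReedSimonIV1978, §XIII.12 Thm XIII.44] -/
theorem corePerronFrobenius_indicator {a : ℝ} {w : ℕ → ℝ} (hw : ∀ n ∈ weilPrimeIndex a, 0 ≤ w n)
    (S : Set ℕ) (ha : 0 < a) : CorePerronFrobenius (S.indicator w) a :=
  corePerronFrobenius (fun n hn ↦ by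
    by_cases hS : n ∈ S
    · rw [Set.indicator_of_mem hS]; exact hw n hn
    · rw [Set.indicator_of_notMem hS]) ha

/-- Non-negative reweightings / dials (`n ↦ K n · w n` with `K ≥ 0` on the prime index): prime
dials `w_p ↦ K w_p` with `K ≥ 0`, deletions (`K = 0`), λ-perturbations keeping the sign.
[cite: ReedSimonIV1978, §XIII.12 Thm XIII.44] -/
theorem corePerronFrobenius_mul {a : ℝ} {w K : ℕ → ℝ} (hw : ∀ n ∈ weilPrimeIndex a, 0 ≤ w n)
    (hK : ∀ n ∈ weilPrimeIndex a, 0 ≤ K n) (ha : 0 < a) :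
    CorePerronFrobenius (fun n ↦ K n * w n) a :=
  corePerronFrobenius (fun n hn ↦ mul_nonneg (hK n hn) (hw n hn)) ha

/-- Non-negative dials of ζ (`n ↦ K n · Λ(n)/√n`, `K ≥ 0` on the prime index).
[cite: ReedSimonIV1978, §XIII.12 Thm XIII.44] -/
theorem corePerronFrobenius_dial_zetaTable {a : ℝ} {K : ℕ → ℝ}
    (hK : ∀ n ∈ weilPrimeIndex a, 0 ≤ K n) (ha : 0 < a) :
    CorePerronFrobenius (fun n ↦ K n * zetaTable n) a :=
  corePerronFrobenius_mul (fun n _ ↦ PfPersistenceDownCone.zetaTable_nonneg n) hK ha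

/-- **Channels (I) and (M) read nothing on the class**: for any two non-negative tables and any
window both cores satisfy the same Perron–Frobenius package — one-signedness, simplicity and parity
of the core ground state do not distinguish members of the class. [folklore] -/
theorem corePerronFrobenius_pair {a : ℝ} {w w' : ℕ → ℝ} (hw : ∀ n ∈ weilPrimeIndex a, 0 ≤ w n)
    (hw' : ∀ n ∈ weilPrimeIndex a, 0 ≤ w' n) (ha : 0 < a) :
    CorePerronFrobenius w a ∧ CorePerronFrobenius w' a :=
  ⟨corePerronFrobenius hw ha, corePerronFrobenius hw' ha⟩

end Summit.RiemannHypothesis.RiemannHypothesis.Theorems.PfPersistence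

end
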